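import Mathlib
import Literature.Uncategorized.MovingShellCutoff
import HarnessLib

/-!
# MovingShellCutoff — the proof (`MovingShellCutoff_holds`)

Discharge of the named fact `Literature.Uncategorized.MovingShellCutoff` (file
`Literature/Uncategorized/MovingShellCutoff.lean`, statement untouched): for a motion `(Λ, c)` of
`E4` and a smooth slow radius profile `ϱ ≥ 1` (`|ϱ′|, |ϱ″|, |ϱ‴| ≤ 1`) there is a `C^∞` function
`χ : E4 → [0, 1]` which, in the rest-frame data `z = Λ⁻¹(x − c)`, `s = ‖z⃗‖`, `t = z⁰`, vanishes
where `s ≤ ϱ(t) + 3/2` or `s ≥ ϱ(t) + 7/2`, equals `1` where `ϱ(t) + 2 ≤ s ≤ ϱ(t) + 3`, and has all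
derivatives of order `≤ 3` bounded on `E4` by one constant.

Construction (standard real analysis, pure Mathlib; this file declares no definition):
* `MovingShellCutoff.exists_bump` — a fixed bump `b : ℝ → [0, 1]`, `b = 0` on
  `(-∞, 3/2] ∪ [7/2, ∞)`, `b = 1` on `[2, 3]` (product of two `Real.smoothTransition`s); smooth with
  compact support, so every derivative is bounded;
* `MovingShellCutoff.norm_iteratedFDeriv_norm_le`, `MovingShellCutoff.exists_smoothedNorm` — a
  smoothed Euclidean norm `M : E3 → ℝ`, `M y = ‖y‖` for `‖y‖ ≥ 1`, `M ≤ ‖·‖`, smooth on all of `E3`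
  (cut off near the origin), whose derivatives of order `1 ≤ i ≤ 3` are bounded on `E3`: on the
  unit ball by compactness, outside it by the degree-one homogeneity of the norm
  (`Dⁱ‖·‖(r u) = r^{1-i} Dⁱ‖·‖(u)`, reduced to the compact unit sphere);
* `MovingShellCutoff.norm_iteratedFDeriv_comp_affine_le`,
  `MovingShellCutoff.norm_iteratedFDeriv_profile_le` — chain rule with the affine rest-frame maps
  and the slowness of `ϱ`;
* `MovingShellCutoff_holds` — `χ x := b (M (Λ⁻¹(x − c))⃗ − ϱ ((Λ⁻¹(x − c))⁰))`; the inner function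
  is smooth with derivatives of order `1 ≤ i ≤ 3` bounded by a constant `D ≥ 1`, and the Faà di
  Bruno bound `norm_iteratedFDeriv_comp_le` gives `‖Dʲχ‖ ≤ j! · B · Dʲ ≤ 6 B D³`.

The same argument was first written Summits-side as `stub_movingShellCutoff`
(`Summits/FinalStateConjecture/FinalStateConjecture/Theorems/StarvedNecksNeckGapDecayStubMovingShellCutoff.lean`);
Literature cannot import Summits, so it is vendored here next to the fact.
-/

namespace Literature.Uncategorized

open scoped ContDiff Topology
open Set Filter Literature.Geometry.Lorentzian

/-! ### The fixed bump `b` -/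

namespace MovingShellCutoff

/-- A smooth bump `b : ℝ → [0, 1]` with `b = 0` on `(-∞, 3/2] ∪ [7/2, ∞)` and `b = 1` on `[2, 3]`,
all of whose derivatives of order `≤ 3` are bounded by one constant: the product of the two
`Real.smoothTransition`s `u ↦ S(2u − 3) · S(7 − 2u)`; it has compact support, so every derivative is
continuous with compact support, hence bounded. [folklore] -/
theorem exists_bump :
    ∃ b : ℝ → ℝ, ContDiff ℝ ∞ b ∧ (∀ u, 0 ≤ b u ∧ b u ≤ 1) ∧ (∀ u, u ≤ 3 / 2 → b u = 0) ∧
      (∀ u, 7 / 2 ≤ u → b u = 0) ∧ (∀ u, 2 ≤ u → u ≤ 3 → b u = 1) ∧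
      ∃ B, ∀ i ≤ 3, ∀ u, ‖iteratedFDeriv ℝ i b u‖ ≤ B := by
  obtain ⟨b, hb⟩ : ∃ b : ℝ → ℝ,
      ∀ u, b u = Real.smoothTransition (2 * u - 3) * Real.smoothTransition (7 - 2 * u) :=
    ⟨_, fun _ ↦ rfl⟩
  have hb' : b = fun u ↦ Real.smoothTransition (2 * u - 3) * Real.smoothTransition (7 - 2 * u) :=
    funext hb
  have hsmooth : ContDiff ℝ ∞ b := by
    rw [hb']
    exact (Real.smoothTransition.contDiff.comp
      ((contDiff_const.mul contDiff_id).sub contDiff_const)).mul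
        (Real.smoothTransition.contDiff.comp (contDiff_const.sub (contDiff_const.mul contDiff_id)))
  have hlow : ∀ u, u ≤ 3 / 2 → b u = 0 := fun u hu ↦ by
    rw [hb, Real.smoothTransition.zero_of_nonpos (by linarith), zero_mul]
  have hhigh : ∀ u, 7 / 2 ≤ u → b u = 0 := fun u hu ↦ by
    rw [hb, Real.smoothTransition.zero_of_nonpos (x := 7 - 2 * u) (by linarith), mul_zero]
  have hsupp : HasCompactSupport b := by
    refine HasCompactSupport.intro (isCompact_Icc : IsCompact (Icc (3 / 2 : ℝ) (7 / 2)))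
      fun u hu ↦ ?_
    rw [mem_Icc, not_and_or, not_le, not_le] at hu
    rcases hu with h | h
    · exact hlow u h.le
    · exact hhigh u h.le
  have hbound : ∀ i, ∃ C, ∀ u, ‖iteratedFDeriv ℝ i b u‖ ≤ C := fun i ↦
    (hsmooth.continuous_iteratedFDeriv (mod_cast le_top)).bounded_above_of_compact_support
      (hsupp.iteratedFDeriv i)
  choose C hC using hbound
  refine ⟨b, hsmooth, fun u ↦ ?_, hlow, hhigh, fun u h2 h3 ↦ ?_, ∑ k ∈ Finset.range 4, |C k|,
    fun i hi u ↦ (hC i u).trans ((le_abs_self _).trans ?_)⟩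
  · rw [hb]
    exact ⟨mul_nonneg (Real.smoothTransition.nonneg _) (Real.smoothTransition.nonneg _),
      mul_le_one₀ (Real.smoothTransition.le_one _) (Real.smoothTransition.nonneg _)
        (Real.smoothTransition.le_one _)⟩
  · rw [hb, Real.smoothTransition.one_of_one_le (by linarith),
      Real.smoothTransition.one_of_one_le (by linarith), mul_one]
  · exact Finset.single_le_sum (f := fun k ↦ |C k|) (fun k _ ↦ abs_nonneg (C k))
      (Finset.mem_range.2 (by omega))

/-! ### Derivatives of the Euclidean norm away from the unit ball -/

/-- **Homogeneity bound.**  Every derivative of order `i ≥ 1` of the Euclidean norm of `E3` is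
bounded on `{1 ≤ ‖y‖}`: by degree-one homogeneity `‖·‖ = r • (‖·‖ ∘ (r⁻¹ • id))` one has
`‖Dⁱ‖·‖(y)‖ ≤ r · ‖Dⁱ‖·‖(y / r)‖ · r⁻ⁱ ≤ ‖Dⁱ‖·‖(y / r)‖` for `r = ‖y‖ ≥ 1`, and the right-hand side
is bounded on the compact unit sphere, where the norm is smooth. [folklore] -/
theorem norm_iteratedFDeriv_norm_le (i : ℕ) (hi : 1 ≤ i) :
    ∃ C, ∀ y : E3, 1 ≤ ‖y‖ → ‖iteratedFDeriv ℝ i (fun y : E3 ↦ ‖y‖) y‖ ≤ C := by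
  have hcont : ContinuousOn (iteratedFDeriv ℝ i (fun y : E3 ↦ ‖y‖)) (Metric.sphere 0 1) := by
    intro u hu
    have hu0 : u ≠ 0 := by
      rintro rfl
      simp at hu
    exact ((contDiffAt_norm ℝ hu0 (n := i)).continuousAt_iteratedFDeriv le_rfl).continuousWithinAt
  obtain ⟨K, hK⟩ := (isCompact_sphere (0 : E3) 1).exists_bound_of_continuousOn hcont
  refine ⟨K, fun y hy ↦ ?_⟩
  set r : ℝ := ‖y‖ with hr_def
  have hr : 0 < r := one_pos.trans_le hy
  -- the dilation `y' ↦ r⁻¹ • y'` as a continuous linear equivalence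
  set e : E3 ≃L[ℝ] E3 := ContinuousLinearEquiv.equivOfInverse
    (r⁻¹ • ContinuousLinearMap.id ℝ E3) (r • ContinuousLinearMap.id ℝ E3)
    (fun y' ↦ by simp [smul_smul, inv_mul_cancel₀ hr.ne'])
    (fun y' ↦ by simp [smul_smul, mul_inv_cancel₀ hr.ne']) with he_def
  have he : ∀ y', e y' = r⁻¹ • y' := fun y' ↦ rfl
  have hey : ‖e y‖ = 1 := by
    rw [he, norm_smul, norm_inv, Real.norm_eq_abs, abs_of_pos hr, ← hr_def, inv_mul_cancel₀ hr.ne']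
  have hey0 : e y ≠ 0 := by
    intro h
    rw [h, norm_zero] at hey
    exact zero_ne_one hey
  have henorm : ‖(e : E3 →L[ℝ] E3)‖ ≤ r⁻¹ := by
    refine ContinuousLinearMap.opNorm_le_bound _ (inv_pos.2 hr).le fun y' ↦ ?_
    rw [ContinuousLinearEquiv.coe_coe, he, norm_smul, norm_inv, Real.norm_eq_abs, abs_of_pos hr]
  -- homogeneity: `‖·‖ = r • (‖·‖ ∘ e)`
  have hfun : (fun y' : E3 ↦ ‖y'‖) = r • ((fun y' : E3 ↦ ‖y'‖) ∘ e) := by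
    ext y'
    simp only [Pi.smul_apply, Function.comp_apply, he, norm_smul, norm_inv, Real.norm_eq_abs,
      abs_of_pos hr, smul_eq_mul]
    rw [mul_inv_cancel_left₀ hr.ne']
  have hcomp : ContDiffAt ℝ i ((fun y' : E3 ↦ ‖y'‖) ∘ e) y :=
    (contDiffAt_norm ℝ hey0).comp y e.contDiff.contDiffAt
  have hright : iteratedFDeriv ℝ i ((fun y' : E3 ↦ ‖y'‖) ∘ e) y =
      (iteratedFDeriv ℝ i (fun y' : E3 ↦ ‖y'‖) (e y)).compContinuousLinearMap
        fun _ ↦ (e : E3 →L[ℝ] E3) := by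
    have h := e.iteratedFDerivWithin_comp_right (fun y' : E3 ↦ ‖y'‖) uniqueDiffOn_univ
      (mem_univ (e y)) i
    rwa [preimage_univ, iteratedFDerivWithin_univ, iteratedFDerivWithin_univ] at h
  have hK0 : 0 ≤ K := (norm_nonneg _).trans (hK (e y) (by simpa using hey))
  calc ‖iteratedFDeriv ℝ i (fun y' : E3 ↦ ‖y'‖) y‖
      = ‖r • iteratedFDeriv ℝ i ((fun y' : E3 ↦ ‖y'‖) ∘ e) y‖ := by
        rw [← iteratedFDeriv_const_smul_apply hcomp, ← hfun]
    _ ≤ r * (‖iteratedFDeriv ℝ i (fun y' : E3 ↦ ‖y'‖) (e y)‖ *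
          ∏ _j : Fin i, ‖(e : E3 →L[ℝ] E3)‖) := by
        rw [norm_smul, Real.norm_eq_abs, abs_of_pos hr, hright]
        exact mul_le_mul_of_nonneg_left
          (ContinuousMultilinearMap.norm_compContinuousLinearMap_le _ _) hr.le
    _ ≤ r * (K * r⁻¹ ^ i) := by
        refine mul_le_mul_of_nonneg_left ?_ hr.le
        rw [Finset.prod_const, Finset.card_univ, Fintype.card_fin]
        exact mul_le_mul (hK _ (by simpa using hey)) (pow_le_pow_left₀ (norm_nonneg _) henorm i)
          (pow_nonneg (norm_nonneg _) i) hK0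
    _ ≤ K := by
        have h1 : r⁻¹ ≤ 1 := inv_le_one_of_one_le₀ hy
        have h2 : r⁻¹ ^ i ≤ r⁻¹ := pow_le_of_le_one (inv_pos.2 hr).le h1 (by omega)
        have h3 : r * (K * r⁻¹ ^ i) ≤ r * (K * r⁻¹) :=
          mul_le_mul_of_nonneg_left (mul_le_mul_of_nonneg_left h2 hK0) hr.le
        have h4 : r * (K * r⁻¹) = K := by field_simp
        linarith

/-- **Smoothed Euclidean norm.**  There is a smooth `M : E3 → ℝ` with `M = ‖·‖` on `{1 ≤ ‖y‖}`,
`M ≤ ‖·‖` everywhere, and all derivatives of order `1 ≤ i ≤ 3` bounded on `E3` by one constant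
(`M y = ‖y‖ · smoothTransition (4‖y‖² − 1)`, which vanishes near the origin; bounds on the unit
ball by compactness and outside it by `norm_iteratedFDeriv_norm_le`). [folklore] -/
theorem exists_smoothedNorm :
    ∃ M : E3 → ℝ, ContDiff ℝ ∞ M ∧ (∀ y, 1 ≤ ‖y‖ → M y = ‖y‖) ∧ (∀ y, M y ≤ ‖y‖) ∧
      ∃ C, ∀ i, 1 ≤ i → i ≤ 3 → ∀ y, ‖iteratedFDeriv ℝ i M y‖ ≤ C := by
  obtain ⟨M, hM⟩ : ∃ M : E3 → ℝ,
      ∀ y, M y = ‖y‖ * Real.smoothTransition (4 * ‖y‖ ^ 2 - 1) := ⟨_, fun _ ↦ rfl⟩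
  have hM' : M = fun y ↦ ‖y‖ * Real.smoothTransition (4 * ‖y‖ ^ 2 - 1) := funext hM
  -- `M` agrees with the norm on the open set `{1/2 < ‖y‖ ^ 2}`
  have heq : ∀ y : E3, 1 / 2 < ‖y‖ ^ 2 → M y = ‖y‖ := fun y hy ↦ by
    rw [hM, Real.smoothTransition.one_of_one_le (by linarith), mul_one]
  have heq1 : ∀ y : E3, 1 ≤ ‖y‖ → M y = ‖y‖ := fun y hy ↦ heq y (by nlinarith)
  have hev : ∀ y : E3, 1 ≤ ‖y‖ → M =ᶠ[𝓝 y] fun y' ↦ ‖y'‖ := fun y hy ↦ by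
    have ho : IsOpen {y' : E3 | 1 / 2 < ‖y'‖ ^ 2} :=
      isOpen_lt continuous_const (continuous_norm.pow 2)
    exact Filter.eventuallyEq_of_mem (ho.mem_nhds (by show 1 / 2 < ‖y‖ ^ 2; nlinarith))
      fun y' hy' ↦ heq y' hy'
  -- `M` vanishes near the origin
  have hev0 : M =ᶠ[𝓝 0] fun _ ↦ 0 := by
    have ho : IsOpen {y' : E3 | ‖y'‖ ^ 2 < 1 / 4} :=
      isOpen_lt (continuous_norm.pow 2) continuous_const
    refine Filter.eventuallyEq_of_mem (ho.mem_nhds (by show ‖(0 : E3)‖ ^ 2 < 1 / 4; simp))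
      fun y' hy' ↦ ?_
    have h : ‖y'‖ ^ 2 < 1 / 4 := hy'
    rw [hM, Real.smoothTransition.zero_of_nonpos (by linarith), mul_zero]
  have hsmooth : ContDiff ℝ ∞ M := by
    refine contDiff_iff_contDiffAt.2 fun y ↦ ?_
    rcases eq_or_ne y 0 with rfl | hy
    · exact (contDiffAt_const (c := (0 : ℝ))).congr_of_eventuallyEq hev0
    · rw [hM']
      exact (contDiffAt_norm ℝ hy).mul (Real.smoothTransition.contDiff.contDiffAt.comp y
        ((contDiff_const.mul (contDiff_norm_sq ℝ)).sub contDiff_const).contDiffAt)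
  have hle : ∀ y, M y ≤ ‖y‖ := fun y ↦ by
    rw [hM]
    exact mul_le_of_le_one_right (norm_nonneg _) (Real.smoothTransition.le_one _)
  -- uniform bounds on the derivatives of order `1 ≤ i`
  have hbound : ∀ i, 1 ≤ i → ∃ C, ∀ y, ‖iteratedFDeriv ℝ i M y‖ ≤ C := by
    intro i hi
    obtain ⟨K₁, hK₁⟩ := (isCompact_closedBall (0 : E3) 1).exists_bound_of_continuousOn
      ((hsmooth.continuous_iteratedFDeriv (m := i) (mod_cast le_top)).continuousOn)
    obtain ⟨K₂, hK₂⟩ := norm_iteratedFDeriv_norm_le i hi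
    refine ⟨max K₁ K₂, fun y ↦ ?_⟩
    rcases le_total ‖y‖ 1 with h | h
    · exact (hK₁ y (mem_closedBall_zero_iff.2 h)).trans (le_max_left _ _)
    · rw [((hev y h).iteratedFDeriv ℝ i).eq_of_nhds]
      exact (hK₂ y h).trans (le_max_right _ _)
  obtain ⟨C₁, hC₁⟩ := hbound 1 le_rfl
  obtain ⟨C₂, hC₂⟩ := hbound 2 one_le_two
  obtain ⟨C₃, hC₃⟩ := hbound 3 (by norm_num)
  refine ⟨M, hsmooth, heq1, hle, max C₁ (max C₂ C₃), fun i hi1 hi3 y ↦ ?_⟩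
  interval_cases i
  · exact (hC₁ y).trans (le_max_left _ _)
  · exact (hC₂ y).trans ((le_max_left _ _).trans (le_max_right _ _))
  · exact (hC₃ y).trans ((le_max_right _ _).trans (le_max_right _ _))

/-! ### Chain rule with affine maps and the slowness of `ϱ` -/

/-- Derivatives of `x ↦ g (T (x - c))` for a continuous linear `T`: `‖Dⁱ‖ ≤ ‖Dⁱ g‖ · ‖T‖ⁱ`
(translation invariance and `ContinuousLinearMap.iteratedFDeriv_comp_right`). [folklore] -/
theorem norm_iteratedFDeriv_comp_affine_le {F : Type*} [NormedAddCommGroup F]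
    [NormedSpace ℝ F] {g : F → ℝ} (hg : ContDiff ℝ ∞ g) (T : E4 →L[ℝ] F) (c x : E4) (i : ℕ) :
    ‖iteratedFDeriv ℝ i (fun x ↦ g (T (x - c))) x‖ ≤
      ‖iteratedFDeriv ℝ i g (T (x - c))‖ * ‖T‖ ^ i := by
  have h1 : iteratedFDeriv ℝ i (fun x ↦ g (T (x - c))) x = iteratedFDeriv ℝ i (g ∘ T) (x - c) :=
    iteratedFDeriv_comp_sub (f := g ∘ ⇑T) i c x
  rw [h1, T.iteratedFDeriv_comp_right hg (x - c) (mod_cast le_top)]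
  refine (ContinuousMultilinearMap.norm_compContinuousLinearMap_le _ _).trans ?_
  rw [Finset.prod_const, Finset.card_univ, Fintype.card_fin]

/-- Slowness of the profile in `iteratedFDeriv` form: `‖Dⁱ ϱ‖ ≤ 1` for `1 ≤ i ≤ 3`
(`‖iteratedFDeriv‖ = |iteratedDeriv|` in one variable). [folklore] -/
theorem norm_iteratedFDeriv_profile_le {ϱ : ℝ → ℝ} (hd1 : ∀ u, |deriv ϱ u| ≤ 1)
    (hd2 : ∀ u, |iteratedDeriv 2 ϱ u| ≤ 1) (hd3 : ∀ u, |iteratedDeriv 3 ϱ u| ≤ 1) {i : ℕ}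
    (hi1 : 1 ≤ i) (hi3 : i ≤ 3) (u : ℝ) : ‖iteratedFDeriv ℝ i ϱ u‖ ≤ 1 := by
  rw [norm_iteratedFDeriv_eq_norm_iteratedDeriv, Real.norm_eq_abs]
  interval_cases i
  · rw [iteratedDeriv_one]; exact hd1 u
  · exact hd2 u
  · exact hd3 u

end MovingShellCutoff

/-! ### The cut-off -/

/-- **W3 — moving two-sided shell cut-off, discharged**: `χ x = b (M (Λ⁻¹(x − c))⃗ − ϱ ((Λ⁻¹(x − c))⁰))`
with the bump `b` of `MovingShellCutoff.exists_bump` and the smoothed norm `M` of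
`MovingShellCutoff.exists_smoothedNorm` (so `χ` is globally `C^∞`, and where `s < 1` the argument is
`≤ 3/2`, i.e. `χ = 0`, consistently with `s ≤ ϱ(t) + 3/2`); the inner function has derivatives of
order `1 ≤ i ≤ 3` bounded by `D = C_M ℓ³ + t³` (`ℓ = max 1 ‖(Λ⁻¹)⃗‖`, `t = max 1 ‖(Λ⁻¹)⁰‖`, slowness
of `ϱ`), and the Faà di Bruno bound `norm_iteratedFDeriv_comp_le` gives the uniform bound
`G = 6 B D³` on all derivatives of order `≤ 3`.  Standard smooth-cutoff construction of real
analysis (same argument as the Summits-side `stub_movingShellCutoff`). [folklore] -/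
theorem MovingShellCutoff_holds : MovingShellCutoff := by
  intro Λ c ϱ hϱ hϱ1 hd1 hd2 hd3
  obtain ⟨b, hb, hb01, hb0, hb0', hb1, B, hB⟩ := MovingShellCutoff.exists_bump
  obtain ⟨M, hM, hM1, hMle, CM, hCM⟩ := MovingShellCutoff.exists_smoothedNorm
  -- the affine rest-frame data: `z = A (x - c)`, `z⃗ = L (x - c)`, `z⁰ = τ (x - c)`
  set A : E4 ≃L[ℝ] E4 := (Λ : E4 ≃L[ℝ] E4).symm with hA_def
  set L : E4 →L[ℝ] E3 := E4.spatial.comp (A : E4 →L[ℝ] E4) with hL_def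
  set τ : E4 →L[ℝ] ℝ := (EuclideanSpace.proj (𝕜 := ℝ) (0 : Fin 4)).comp (A : E4 →L[ℝ] E4)
    with hτ_def
  have hLx : ∀ x, ‖L (x - c)‖ = E4.spatialNorm (poincareInv Λ c x) := fun x ↦ rfl
  have hτx : ∀ x, τ (x - c) = poincareInv Λ c x 0 := fun x ↦ rfl
  -- the argument of the bump
  obtain ⟨f, hf⟩ : ∃ f : E4 → ℝ, ∀ x, f x = M (L (x - c)) - ϱ (τ (x - c)) := ⟨_, fun _ ↦ rfl⟩
  have hf' : f = fun x ↦ M (L (x - c)) - ϱ (τ (x - c)) := funext hf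
  have hML : ContDiff ℝ ∞ fun x ↦ M (L (x - c)) :=
    hM.comp (L.contDiff.comp (contDiff_id.sub contDiff_const))
  have hϱτ : ContDiff ℝ ∞ fun x ↦ ϱ (τ (x - c)) :=
    hϱ.comp (τ.contDiff.comp (contDiff_id.sub contDiff_const))
  have hfs : ContDiff ℝ ∞ f := by
    rw [hf']
    exact hML.sub hϱτ
  -- on `{1 ≤ s}` the argument is `s - ϱ(t)`; on `{s < 1}` it is at most `3/2`
  have hf_of_le : ∀ x, 1 ≤ E4.spatialNorm (poincareInv Λ c x) →
      f x = E4.spatialNorm (poincareInv Λ c x) - ϱ (poincareInv Λ c x 0) := fun x hx ↦ by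
    rw [hf, ← hLx, ← hτx, hM1 _ (by rwa [hLx])]
  have hf_of_lt : ∀ x, E4.spatialNorm (poincareInv Λ c x) < 1 → f x ≤ 3 / 2 := fun x hx ↦ by
    have h1 := hMle (L (x - c))
    have h2 := hϱ1 (τ (x - c))
    rw [hLx] at h1
    rw [hf]
    linarith
  -- the constants
  have hCM0 : 0 ≤ CM := (norm_nonneg _).trans (hCM 1 le_rfl (by norm_num) 0)
  have hB0 : 0 ≤ B := (norm_nonneg _).trans (hB 0 (Nat.zero_le _) 0)
  set ℓ : ℝ := max 1 ‖L‖ with hℓ_def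
  set t : ℝ := max 1 ‖τ‖ with ht_def
  set D : ℝ := CM * ℓ ^ 3 + t ^ 3 with hD_def
  have hℓ1 : 1 ≤ ℓ := le_max_left _ _
  have ht1 : 1 ≤ t := le_max_left _ _
  have hD1 : 1 ≤ D := by
    have h1 : 0 ≤ CM * ℓ ^ 3 := mul_nonneg hCM0 (pow_nonneg (zero_le_one.trans hℓ1) 3)
    have h2 : 1 ≤ t ^ 3 := one_le_pow₀ ht1
    linarith
  -- derivatives of the argument of order `1 ≤ i ≤ 3` are bounded by `D ≤ D ^ i`
  have hDf : ∀ i, 1 ≤ i → i ≤ 3 → ∀ x, ‖iteratedFDeriv ℝ i f x‖ ≤ D ^ i := by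
    intro i hi1 hi3 x
    have hsub : iteratedFDeriv ℝ i f x = iteratedFDeriv ℝ i (fun x ↦ M (L (x - c))) x -
        iteratedFDeriv ℝ i (fun x ↦ ϱ (τ (x - c))) x := by
      rw [hf']
      exact fun_iteratedFDeriv_sub_apply (hML.contDiffAt.of_le (mod_cast le_top))
        (hϱτ.contDiffAt.of_le (mod_cast le_top))
    have h1 : ‖iteratedFDeriv ℝ i (fun x ↦ M (L (x - c))) x‖ ≤ CM * ℓ ^ 3 := by
      refine (MovingShellCutoff.norm_iteratedFDeriv_comp_affine_le hM L c x i).trans ?_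
      have h3 : ‖L‖ ^ i ≤ ℓ ^ 3 :=
        (pow_le_pow_left₀ (norm_nonneg _) (le_max_right _ _) i).trans (pow_le_pow_right₀ hℓ1 hi3)
      exact mul_le_mul (hCM i hi1 hi3 _) h3 (pow_nonneg (norm_nonneg _) i) hCM0
    have h2 : ‖iteratedFDeriv ℝ i (fun x ↦ ϱ (τ (x - c))) x‖ ≤ t ^ 3 := by
      refine (MovingShellCutoff.norm_iteratedFDeriv_comp_affine_le hϱ τ c x i).trans ?_
      have h3 : ‖τ‖ ^ i ≤ t ^ 3 :=
        (pow_le_pow_left₀ (norm_nonneg _) (le_max_right _ _) i).trans (pow_le_pow_right₀ ht1 hi3)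
      have h4 := MovingShellCutoff.norm_iteratedFDeriv_profile_le hd1 hd2 hd3 hi1 hi3 (τ (x - c))
      calc ‖iteratedFDeriv ℝ i ϱ (τ (x - c))‖ * ‖τ‖ ^ i ≤ 1 * t ^ 3 :=
            mul_le_mul h4 h3 (pow_nonneg (norm_nonneg _) i) zero_le_one
        _ = t ^ 3 := one_mul _
    calc ‖iteratedFDeriv ℝ i f x‖ ≤ ‖iteratedFDeriv ℝ i (fun x ↦ M (L (x - c))) x‖ +
          ‖iteratedFDeriv ℝ i (fun x ↦ ϱ (τ (x - c))) x‖ := by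
          rw [hsub]
          exact norm_sub_le _ _
      _ ≤ D := add_le_add h1 h2
      _ ≤ D ^ i := le_self_pow₀ hD1 (by omega)
  refine ⟨fun x ↦ b (f x), 6 * B * D ^ 3, hb.comp hfs, fun x ↦ hb01 (f x), fun x hx ↦ ?_,
    fun x hx ↦ ?_, fun x hx hx' ↦ ?_, fun j hj x ↦ ?_⟩
  · -- `χ = 0` where `s ≤ ϱ(t) + 3/2`
    refine hb0 _ ?_
    rcases le_or_gt 1 (E4.spatialNorm (poincareInv Λ c x)) with h1 | h1
    · rw [hf_of_le x h1]
      linarith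
    · exact hf_of_lt x h1
  · -- `χ = 0` where `ϱ(t) + 7/2 ≤ s`
    have h1 : 1 ≤ E4.spatialNorm (poincareInv Λ c x) := by linarith [hϱ1 (poincareInv Λ c x 0)]
    refine hb0' _ ?_
    rw [hf_of_le x h1]
    linarith
  · -- `χ = 1` where `ϱ(t) + 2 ≤ s ≤ ϱ(t) + 3`
    have h1 : 1 ≤ E4.spatialNorm (poincareInv Λ c x) := by linarith [hϱ1 (poincareInv Λ c x 0)]
    refine hb1 _ ?_ ?_
    · rw [hf_of_le x h1]
      linarith
    · rw [hf_of_le x h1]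
      linarith
  · -- the uniform bound on all derivatives of order `j ≤ 3` (Faà di Bruno)
    have key : ‖iteratedFDeriv ℝ j (b ∘ f) x‖ ≤ (j.factorial : ℝ) * B * D ^ j :=
      norm_iteratedFDeriv_comp_le hb hfs (mod_cast le_top) x
        (fun i hi ↦ hB i (hi.trans hj) (f x)) (fun i hi1 hij ↦ hDf i hi1 (hij.trans hj) x)
    have h1 : (j.factorial : ℝ) ≤ 6 := by
      exact_mod_cast (Nat.factorial_le hj : j.factorial ≤ Nat.factorial 3)
    have h2 : D ^ j ≤ D ^ 3 := pow_le_pow_right₀ hD1 hj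
    calc ‖iteratedFDeriv ℝ j (fun x ↦ b (f x)) x‖ = ‖iteratedFDeriv ℝ j (b ∘ f) x‖ := rfl
      _ ≤ (j.factorial : ℝ) * B * D ^ j := key
      _ ≤ 6 * B * D ^ 3 :=
          mul_le_mul (mul_le_mul_of_nonneg_right h1 hB0) h2 (pow_nonneg (zero_le_one.trans hD1) j)
            (mul_nonneg (by norm_num) hB0)

end Literature.Uncategorized
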